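import Literature.AlgebraicGeometry.ModuliOfAbelianVarieties.SiegelConjFibreIsoEqCMIso
import Literature.AlgebraicGeometry.ModuliOfAbelianVarieties.SiegelAdmissibleOfIso
import Literature.AlgebraicGeometry.AbelianSchemes.AbelianSchemeFibreFrobeniusTwistHom
import HarnessLib

/-!
# The CM homomorphism into a SECOND admissibly marked fibre composed with a tuple isomorphism back is the canonical identification;
# hence the tuple isomorphism intertwines the endomorphisms ([Milne2005ShimuraVarieties] §14 Prop. 14.12, Thm. 6.11; [Deligne1971TravauxShimura] 4.16–4.19)

Topic `AlgebraicGeometry/ModuliOfAbelianVarieties`; namespace `Literature.AlgebraicGeometry.ModuliOfAbelianVarieties.SiegelAdelicMarking`.  THEOREMS ONLY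
(no definition, no named fact, no instance, no notation, no `sorry`).  Sequel of ★ `SiegelConjFibreIsoEqCMIso` (the ONE-family kernel `f = conjFibreIso`)
for TWO families.  Cell `hodgecm-mathlib` (D-0151), FLOOR 0, P6 «MOD» (crux hLiu418 = stmt-HodgeConjecture-24832, `--supports`): organ **(R-CM-3) «the CM hom IS
the tuple iso»** of the (γ′) road for the E-sheet socket `hole_SHEET_complex` (LA4-plan (g2) BOOK v3; cut LA4-p03 (g3) 2026-09-02 09:02Z): LEG-E's fine-moduli
fibre isomorphism `e : (B_X)_{z₀} ≅ P_{ℓ_{τE∘γ} z₀} = P_{Spec σ ≫ x₁}` between the Serre-tensor fibre and the conjugate-sheet fibre of the universal pull-back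
INTERTWINES the two `𝒪_F`-actions, because (R-CM-1)'s CM homomorphism `f : (P_{x₁})^σ → (B_X)_{z₀}` composed with `e` is the canonical `conjFibreIso` —
the `h` of ★ (R-RIG) `RecordSystemGS.forall_comp_eq_comp_of_forall_specialPoint_sheet` at the special points.  HC_CM is proved only modulo the printed
citations (2 remaining named inputs hLiu418 24832, h413 24833) until rung 0 closes; this file is generic and changes no count.

SETTING.  ONE abelian scheme `B → S` with dual pair `D`, `λ`, level-`N` structure `φ` (`N ≥ 3`), a complex point `s`, `σ ∈ Aut(ℂ/ℚ)`, and at `s` the CM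
datum of the kernel (marking `m₁` by `[J, a]`, `λ`-witness `Θ₁`, symplectic lift `Λ₁` read through `m₁`).  A SECOND abelian scheme `B′ → S′` with level-`N`
structure `φ′`, a complex point `s′` and an ADMISSIBILITY DATUM there: marking `m₂` by `[j(Z), r]`, `r ∈ K_δ(1)`, symplectic lift `Λ₂` of `(φ′, Θ₂)` read
through `m₂`.  An ISOMORPHISM `e : B′_{s′} ≅ B_{Spec σ ≫ s}` OF TRIPLES in point currency: it carries the level sections of `φ′` at `s′` to those of `φ` at
`Spec σ ≫ s` (`he`) and pushes `Θ₂` to a `λ`-witness at `Spec σ ≫ s` (`heΘ`).  A HOMOMORPHISM `f : (B_s)^σ → B′_{s′}` with the `K_δ(N)`-twisted CM torsion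
reading `f((m₁.r v)^σ) = m₂.r w` for `k a⁻¹ v̂ ≡ r⁻¹ ŵ` (★ `CMConjugationIsogenyAll` re-indexed; (R-CM-1)).
THEN (§1) **`f ≫ e = conjFibreIso B σ s`**: transport the admissibility datum `(m₂, Θ₂, Λ₂)` along `e` (★ `SiegelAdelicMarking.exists_of_iso`, ★
`SymplecticLift.exists_transport_lift_eq`) to one at `B_{Spec σ ≫ s}`, for which `f ≫ e` has the twisted reading; the kernel ★ `hom_eq_conjFibreIso_hom_of_lifts`
(lemma of Serre) concludes.  (§2) `f` is an isomorphism (★ R60-57b) and `e = f⁻¹ ≫ conjFibreIso`; with ★ E6-γ-A₂ `conjugate_comp_eq_comp_of_adelicCongr₂`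
(`y^σ ≫ f = f ≫ y′` for endomorphisms reading a congruence-preserving pair `(ℓ, ℓ′)` through `m₁`, `m₂`) and the naturality ★
`conjugate_fibreHom_comp_conjFibreIso_hom`, **`y′ ≫ e = e ≫ F_{Spec σ ≫ s}`** for every GLOBAL endomorphism `F` of `B` whose fibre at `s` reads `ℓ` through `m₁`.

* §1 **`comp_iso_hom_eq_conjFibreIso_hom_of_lifts`** — THE HEAD; `isIso_of_twisted_reading`, `iso_hom_eq_inv_comp_conjFibreIso_hom_of_lifts`.
* §2 **`comp_iso_hom_eq_iso_hom_comp_fibreHom_of_lifts`** — the tuple iso intertwines `y′` with the fibre of the global `F` at the twisted point (from the CM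
  hom's intertwining `hint`); `…_of_readings` — the same from marked readings via ★ E6-γ-A₂.

## References
* [Milne2005ShimuraVarieties] J. S. Milne, *Introduction to Shimura varieties* (2005), §14 Prop. 14.12 p. 125, §6 Thm. 6.11 pp. 74–75, §11 Thm. 11.2 p. 108.
* [Deligne1971TravauxShimura] P. Deligne, *Travaux de Shimura* (1971), 4.16–4.19 pp. 150–151.
* [MumfordFogartyKirwan1994] D. Mumford, J. Fogarty, F. Kirwan, *Geometric Invariant Theory*, 3rd ed. (1994), Ch. 7 §3 (lemma of Serre).
* [Shimura1998] G. Shimura, *Abelian Varieties with Complex Multiplication and Modular Functions* (1998), §21.4 p. 192, §18.6.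
-/

set_option autoImplicit false

noncomputable section

open Matrix CategoryTheory AlgebraicGeometry
open Literature.AlgebraicGeometry.Motives (AbelianVariety AlgPoints CartierDivisor)
open Literature.AlgebraicGeometry.AbelianSchemes (AbelianSchemeOver)
open Literature.AlgebraicGeometry.AbelianSchemes.AbelianSchemeOver (fibreHom conjugate_fibreHom_comp_conjFibreIso_hom)
open Literature.NumberTheory.Automorphic (siegelUpperHalfSpace)

namespace Literature.AlgebraicGeometry.ModuliOfAbelianVarieties

namespace SiegelAdelicMarking

open SiegelModuli

variable {g : ℕ} {δ : Fin g → ℕ} {J : C0pm δ} {a k : gspFinAdelic δ}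
variable {N : ℕ} {S : Scheme} {B : AbelianSchemeOver S} {s : Spec (CommRingCat.of ℂ) ⟶ S} {D : B.DualPair} {lam : B.X ⟶ D.hat.X}
  {φ : B.LevelStructure g N} {r : gspFinAdelic δ} {Z : Matrix (Fin g) (Fin g) ℂ}
variable {S' : Scheme} {B' : AbelianSchemeOver S'} {s' : Spec (CommRingCat.of ℂ) ⟶ S'} {φ' : B'.LevelStructure g N}

/-! ### §1 The head: `f ≫ e = conjFibreIso` -/

set_option maxHeartbeats 400000 in
/-- **(R-CM-3) — THE CM HOMOMORPHISM FOLLOWED BY THE TUPLE ISOMORPHISM IS THE CANONICAL IDENTIFICATION.**  With the setting of the module docstring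
(kernel CM datum `(m₁, Θ₁, Λ₁)` at `s`; admissibility datum `(m₂, Θ₂, Λ₂)` at the point `s′` of the SECOND family `B′`; an isomorphism `e : B′_{s′} ≅ B_{Spec σ ≫ s}`
carrying the level sections of `φ′` to those of `φ` (`he`) and pushing `Θ₂` to a `λ`-witness (`heΘ`); a homomorphism `f : (B_s)^σ → B′_{s′}` with the
`K_δ(N)`-twisted CM reading (`hf`)): **`f ≫ e.hom = (conjFibreIso B σ s).hom`** — the admissibility datum moves along `e` (★ `exists_of_iso`, ★
`SymplecticLift.exists_transport_lift_eq`) and the one-family kernel ★ `hom_eq_conjFibreIso_hom_of_lifts` (lemma of Serre, `N ≥ 3`) applies to `f ≫ e`.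
[cite: Milne2005ShimuraVarieties, §14 Prop. 14.12 p. 125; §6 Thm. 6.11 pp. 74–75] [cite: Deligne1971TravauxShimura, 4.16 p. 150] [cite: MumfordFogartyKirwan1994, Ch. 7 §3 (lemma of Serre)] -/
theorem comp_iso_hom_eq_conjFibreIso_hom_of_lifts (hg : 0 < g) (hδ : IsPolarizationType δ) (hN : 3 ≤ N)
    (σ : ℂ ≃ₐ[ℚ] ℂ)
    -- the CM datum at `s`
    {Θ₁ : CartierDivisor (B.fibre s).toAbelianVariety.X.left} (h₁ : B.IsLambdaOfAt s D lam Θ₁)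
    (Λ₁ : φ.SymplecticLift s Θ₁ δ) (m₁ : SiegelAdelicMarking J a (B.fibre s).toAbelianVariety)
    (hΛ₁ : ∀ ⦃M : ℕ⦄, N ∣ M → M ≠ 0 → ∀ (x : Fin g ⊕ Fin g → ZMod M) (v : Fin g ⊕ Fin g → ℚ),
      AdelicCongr ((a⁻¹ : gspFinAdelic δ) : GL (Fin g ⊕ Fin g) finAdeleQ) 1 v (fun i => ((x i).val : ℚ) / M) →
        ((Λ₁.lift M (Multiplicative.ofAdd x)) : (B.fibre s).toAbelianVariety.Points ℂ) = m₁.r v)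
    -- the admissibility datum at the point `s′` of the second family
    (hr : r ∈ principalLevelSubgroup δ 1) (hZ : Z ∈ siegelUpperHalfSpace g)
    (m₂ : SiegelAdelicMarking ⟨jOfSiegel δ Z, SiegelComplexRecordSystem.jOfSiegel_mem_C0pm hδ.1 hZ⟩ r (B'.fibre s').toAbelianVariety)
    {Θ₂ : CartierDivisor (B'.fibre s').toAbelianVariety.X.left} (Λ₂ : φ'.SymplecticLift s' Θ₂ δ)
    (hΛ₂ : ∀ ⦃M : ℕ⦄, N ∣ M → M ≠ 0 → ∀ (x : Fin g ⊕ Fin g → ZMod M) (v : Fin g ⊕ Fin g → ℚ),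
      AdelicCongr ((r⁻¹ : gspFinAdelic δ) : GL (Fin g ⊕ Fin g) finAdeleQ) 1 v (fun i => ((x i).val : ℚ) / M) →
        ((Λ₂.lift M (Multiplicative.ofAdd x)) : (B'.fibre s').toAbelianVariety.Points ℂ) = m₂.r v)
    -- the tuple isomorphism `e : B′_{s′} ≅ B_{Spec σ ≫ s}` (level sections and `λ`-witness)
    (e : (B'.fibre s').toAbelianVariety ≅ (B.fibre (AbelianSchemeOver.specTwist σ.toRingEquiv ≫ s)).toAbelianVariety)
    (he : ∀ i : Fin g ⊕ Fin g, AlgPoints.map e.hom.hom.hom.hom (B'.restrictPt s' (φ'.σ i)) =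
      B.restrictPt (AbelianSchemeOver.specTwist σ.toRingEquiv ≫ s) (φ.σ i))
    (heΘ : haveI := AbelianVariety.isDominant_toSchemeHom_iso_hom e.symm
      B.IsLambdaOfAt (AbelianSchemeOver.specTwist σ.toRingEquiv ≫ s) D lam (Θ₂.pullback (AbelianVariety.Hom.toSchemeHom e.symm.hom)))
    -- the CM homomorphism with the twisted reading
    (f : ((B.fibre s).toAbelianVariety).conjugate σ.toRingEquiv ⟶ (B'.fibre s').toAbelianVariety)
    (hk : k ∈ principalLevelSubgroup δ N)
    (hf : ∀ v w : Fin g ⊕ Fin g → ℚ,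
      AdelicCongr ((k * a⁻¹ : gspFinAdelic δ) : GL (Fin g ⊕ Fin g) finAdeleQ)
          ((r⁻¹ : gspFinAdelic δ) : GL (Fin g ⊕ Fin g) finAdeleQ) v w →
        AlgPoints.map f.hom.hom.hom ((B.fibre s).toAbelianVariety.conjPoints σ.toRingEquiv (m₁.r v)) = m₂.r w) :
    f ≫ e.hom = (B.conjFibreIso σ.toRingEquiv s).hom := by
  haveI := AbelianVariety.isDominant_toSchemeHom_iso_hom e.symm
  -- (1) the marking `m₂` pushed along `e`: a marking of `B_{Spec σ ≫ s}` by the SAME `[j(Z), r]` with `m₂′.r = e ∘ m₂.r`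
  obtain ⟨m₂', -, hm₂'⟩ := m₂.exists_of_iso e
  -- (2) the symplectic lift `Λ₂` carried along `e` (read backwards along `e.symm`): a lift of `φ` at `Spec σ ≫ s` for `(e⁻¹)^*Θ₂`
  have he' : ∀ i : Fin g ⊕ Fin g, AlgPoints.map e.symm.hom.hom.hom.hom
      (B.restrictPt (AbelianSchemeOver.specTwist σ.toRingEquiv ≫ s) (φ.σ i)) = B'.restrictPt s' (φ'.σ i) := by
    intro i
    rw [← he i, ← AlgPoints.map_comp_apply]
    change AlgPoints.map (e.hom ≫ e.inv).hom.hom.hom _ = _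
    rw [e.hom_inv_id]
    exact AlgPoints.map_id_apply _
  obtain ⟨Λ₂', -, hΛ₂'⟩ := AbelianSchemeOver.LevelStructure.SymplecticLift.exists_transport_lift_eq e.symm he' Λ₂
  -- its tower reads through `m₂′`
  have hΛ₂'' : ∀ ⦃M : ℕ⦄, N ∣ M → M ≠ 0 → ∀ (x : Fin g ⊕ Fin g → ZMod M) (v : Fin g ⊕ Fin g → ℚ),
      AdelicCongr ((r⁻¹ : gspFinAdelic δ) : GL (Fin g ⊕ Fin g) finAdeleQ) 1 v (fun i => ((x i).val : ℚ) / M) →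
        ((Λ₂'.lift M (Multiplicative.ofAdd x)) :
            (B.fibre (AbelianSchemeOver.specTwist σ.toRingEquiv ≫ s)).toAbelianVariety.Points ℂ) = m₂'.r v := by
    intro M hNM hM0 x v hv
    rw [hΛ₂' M (Multiplicative.ofAdd x), hΛ₂ hNM hM0 x v hv, hm₂' v]
    rfl
  -- (3) `f ≫ e` has the twisted CM reading with respect to `(m₁, m₂′)`
  have hf' : ∀ v w : Fin g ⊕ Fin g → ℚ,
      AdelicCongr ((k * a⁻¹ : gspFinAdelic δ) : GL (Fin g ⊕ Fin g) finAdeleQ)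
          ((r⁻¹ : gspFinAdelic δ) : GL (Fin g ⊕ Fin g) finAdeleQ) v w →
        AlgPoints.map (f ≫ e.hom).hom.hom.hom ((B.fibre s).toAbelianVariety.conjPoints σ.toRingEquiv (m₁.r v)) = m₂'.r w := by
    intro v w hvw
    change AlgPoints.map (f.hom.hom.hom ≫ e.hom.hom.hom.hom) _ = _
    rw [AlgPoints.map_comp_apply, hf v w hvw, hm₂' w]
  -- (4) the one-family kernel (lemma of Serre)
  exact hom_eq_conjFibreIso_hom_of_lifts hg hδ hN σ h₁ Λ₁ m₁ hΛ₁ hr hZ m₂' Λ₂' heΘ hΛ₂'' (f ≫ e.hom) hk hf'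

/-- **The CM homomorphism with the `K_δ(N)`-twisted reading into a marked complex abelian variety is an isomorphism** (★ R60-57b
`isIso_of_mem_principalLevelSubgroup_forall_adelicCongr`, restated in the letters of this file for the consumers).
[cite: Milne2005ShimuraVarieties, §6 Thm. 6.11 pp. 74–75] [cite: MumfordAV1970, §19 Thm. 3 and Cor. 1] -/
theorem isIso_of_twisted_reading (σ : ℂ ≃ₐ[ℚ] ℂ) (m₁ : SiegelAdelicMarking J a (B.fibre s).toAbelianVariety)
    (hZ : Z ∈ siegelUpperHalfSpace g) (hδ : IsPolarizationType δ)
    (m₂ : SiegelAdelicMarking ⟨jOfSiegel δ Z, SiegelComplexRecordSystem.jOfSiegel_mem_C0pm hδ.1 hZ⟩ r (B'.fibre s').toAbelianVariety)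
    (f : ((B.fibre s).toAbelianVariety).conjugate σ.toRingEquiv ⟶ (B'.fibre s').toAbelianVariety)
    (hk : k ∈ principalLevelSubgroup δ N)
    (hf : ∀ v w : Fin g ⊕ Fin g → ℚ,
      AdelicCongr ((k * a⁻¹ : gspFinAdelic δ) : GL (Fin g ⊕ Fin g) finAdeleQ)
          ((r⁻¹ : gspFinAdelic δ) : GL (Fin g ⊕ Fin g) finAdeleQ) v w →
        AlgPoints.map f.hom.hom.hom ((B.fibre s).toAbelianVariety.conjPoints σ.toRingEquiv (m₁.r v)) = m₂.r w) :
    IsIso f :=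
  isIso_of_mem_principalLevelSubgroup_forall_adelicCongr σ hk m₁ m₂ f hf

set_option maxHeartbeats 400000 in
/-- **The tuple isomorphism IS the CM isomorphism**: with the data of `comp_iso_hom_eq_conjFibreIso_hom_of_lifts`, **`e.hom = f⁻¹ ≫ conjFibreIso B σ s`**
(`f` is an isomorphism by `isIso_of_twisted_reading`). [cite: Milne2005ShimuraVarieties, §14 Prop. 14.12 p. 125; §6 Thm. 6.11 pp. 74–75]
[cite: MumfordFogartyKirwan1994, Ch. 7 §3 (lemma of Serre)] -/
theorem iso_hom_eq_inv_comp_conjFibreIso_hom_of_lifts (hg : 0 < g) (hδ : IsPolarizationType δ) (hN : 3 ≤ N)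
    (σ : ℂ ≃ₐ[ℚ] ℂ)
    {Θ₁ : CartierDivisor (B.fibre s).toAbelianVariety.X.left} (h₁ : B.IsLambdaOfAt s D lam Θ₁)
    (Λ₁ : φ.SymplecticLift s Θ₁ δ) (m₁ : SiegelAdelicMarking J a (B.fibre s).toAbelianVariety)
    (hΛ₁ : ∀ ⦃M : ℕ⦄, N ∣ M → M ≠ 0 → ∀ (x : Fin g ⊕ Fin g → ZMod M) (v : Fin g ⊕ Fin g → ℚ),
      AdelicCongr ((a⁻¹ : gspFinAdelic δ) : GL (Fin g ⊕ Fin g) finAdeleQ) 1 v (fun i => ((x i).val : ℚ) / M) →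
        ((Λ₁.lift M (Multiplicative.ofAdd x)) : (B.fibre s).toAbelianVariety.Points ℂ) = m₁.r v)
    (hr : r ∈ principalLevelSubgroup δ 1) (hZ : Z ∈ siegelUpperHalfSpace g)
    (m₂ : SiegelAdelicMarking ⟨jOfSiegel δ Z, SiegelComplexRecordSystem.jOfSiegel_mem_C0pm hδ.1 hZ⟩ r (B'.fibre s').toAbelianVariety)
    {Θ₂ : CartierDivisor (B'.fibre s').toAbelianVariety.X.left} (Λ₂ : φ'.SymplecticLift s' Θ₂ δ)
    (hΛ₂ : ∀ ⦃M : ℕ⦄, N ∣ M → M ≠ 0 → ∀ (x : Fin g ⊕ Fin g → ZMod M) (v : Fin g ⊕ Fin g → ℚ),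
      AdelicCongr ((r⁻¹ : gspFinAdelic δ) : GL (Fin g ⊕ Fin g) finAdeleQ) 1 v (fun i => ((x i).val : ℚ) / M) →
        ((Λ₂.lift M (Multiplicative.ofAdd x)) : (B'.fibre s').toAbelianVariety.Points ℂ) = m₂.r v)
    (e : (B'.fibre s').toAbelianVariety ≅ (B.fibre (AbelianSchemeOver.specTwist σ.toRingEquiv ≫ s)).toAbelianVariety)
    (he : ∀ i : Fin g ⊕ Fin g, AlgPoints.map e.hom.hom.hom.hom (B'.restrictPt s' (φ'.σ i)) =
      B.restrictPt (AbelianSchemeOver.specTwist σ.toRingEquiv ≫ s) (φ.σ i))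
    (heΘ : haveI := AbelianVariety.isDominant_toSchemeHom_iso_hom e.symm
      B.IsLambdaOfAt (AbelianSchemeOver.specTwist σ.toRingEquiv ≫ s) D lam (Θ₂.pullback (AbelianVariety.Hom.toSchemeHom e.symm.hom)))
    (f : ((B.fibre s).toAbelianVariety).conjugate σ.toRingEquiv ⟶ (B'.fibre s').toAbelianVariety)
    (hk : k ∈ principalLevelSubgroup δ N)
    (hf : ∀ v w : Fin g ⊕ Fin g → ℚ,
      AdelicCongr ((k * a⁻¹ : gspFinAdelic δ) : GL (Fin g ⊕ Fin g) finAdeleQ)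
          ((r⁻¹ : gspFinAdelic δ) : GL (Fin g ⊕ Fin g) finAdeleQ) v w →
        AlgPoints.map f.hom.hom.hom ((B.fibre s).toAbelianVariety.conjPoints σ.toRingEquiv (m₁.r v)) = m₂.r w) :
    haveI := isIso_of_twisted_reading σ m₁ hZ hδ m₂ f hk hf
    e.hom = inv f ≫ (B.conjFibreIso σ.toRingEquiv s).hom := by
  haveI := isIso_of_twisted_reading σ m₁ hZ hδ m₂ f hk hf
  rw [← comp_iso_hom_eq_conjFibreIso_hom_of_lifts hg hδ hN σ h₁ Λ₁ m₁ hΛ₁ hr hZ m₂ Λ₂ hΛ₂ e he heΘ f hk hf,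
    IsIso.inv_hom_id_assoc]

/-! ### §2 The tuple isomorphism intertwines the endomorphisms -/

set_option maxHeartbeats 400000 in
/-- **(R-CM) AT A SPECIAL POINT — THE TUPLE ISOMORPHISM INTERTWINES.**  With the data of `comp_iso_hom_eq_conjFibreIso_hom_of_lifts`, let `F : B → B` be a
GLOBAL homomorphism of the first family (e.g. `F = ι(b)`) and `y′` an endomorphism of `B′_{s′}` (e.g. the Serre-tensor action on the fibre) which the CM hom
INTERTWINES: `(F_s)^σ ≫ f = f ≫ y′` (`hint` — (R-CM-2), ★ E6-γ-A₂ `conjugate_comp_eq_comp_of_adelicCongr₂` from the readings).  Then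
**`y′ ≫ e.hom = e.hom ≫ F_{Spec σ ≫ s}`**: `f ≫ e = conjFibreIso` (§1), `f` is invertible, and `conjFibreIso` is natural in `F` (★
`conjugate_fibreHom_comp_conjFibreIso_hom`).  This is the fibre identity `hact` consumed, one special point per connected component, by ★ (R-RIG)
`RecordSystemGS.forall_comp_eq_comp_of_forall_specialPoint_sheet`.
[cite: Milne2005ShimuraVarieties, §14 Prop. 14.12 p. 125 and §11 Thm. 11.2 p. 108] [cite: Shimura1998, §21.4 p. 192] [cite: MumfordFogartyKirwan1994, Ch. 7 §3 (lemma of Serre)] -/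
theorem comp_iso_hom_eq_iso_hom_comp_fibreHom_of_lifts (hg : 0 < g) (hδ : IsPolarizationType δ) (hN : 3 ≤ N)
    (σ : ℂ ≃ₐ[ℚ] ℂ)
    {Θ₁ : CartierDivisor (B.fibre s).toAbelianVariety.X.left} (h₁ : B.IsLambdaOfAt s D lam Θ₁)
    (Λ₁ : φ.SymplecticLift s Θ₁ δ) (m₁ : SiegelAdelicMarking J a (B.fibre s).toAbelianVariety)
    (hΛ₁ : ∀ ⦃M : ℕ⦄, N ∣ M → M ≠ 0 → ∀ (x : Fin g ⊕ Fin g → ZMod M) (v : Fin g ⊕ Fin g → ℚ),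
      AdelicCongr ((a⁻¹ : gspFinAdelic δ) : GL (Fin g ⊕ Fin g) finAdeleQ) 1 v (fun i => ((x i).val : ℚ) / M) →
        ((Λ₁.lift M (Multiplicative.ofAdd x)) : (B.fibre s).toAbelianVariety.Points ℂ) = m₁.r v)
    (hr : r ∈ principalLevelSubgroup δ 1) (hZ : Z ∈ siegelUpperHalfSpace g)
    (m₂ : SiegelAdelicMarking ⟨jOfSiegel δ Z, SiegelComplexRecordSystem.jOfSiegel_mem_C0pm hδ.1 hZ⟩ r (B'.fibre s').toAbelianVariety)
    {Θ₂ : CartierDivisor (B'.fibre s').toAbelianVariety.X.left} (Λ₂ : φ'.SymplecticLift s' Θ₂ δ)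
    (hΛ₂ : ∀ ⦃M : ℕ⦄, N ∣ M → M ≠ 0 → ∀ (x : Fin g ⊕ Fin g → ZMod M) (v : Fin g ⊕ Fin g → ℚ),
      AdelicCongr ((r⁻¹ : gspFinAdelic δ) : GL (Fin g ⊕ Fin g) finAdeleQ) 1 v (fun i => ((x i).val : ℚ) / M) →
        ((Λ₂.lift M (Multiplicative.ofAdd x)) : (B'.fibre s').toAbelianVariety.Points ℂ) = m₂.r v)
    (e : (B'.fibre s').toAbelianVariety ≅ (B.fibre (AbelianSchemeOver.specTwist σ.toRingEquiv ≫ s)).toAbelianVariety)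
    (he : ∀ i : Fin g ⊕ Fin g, AlgPoints.map e.hom.hom.hom.hom (B'.restrictPt s' (φ'.σ i)) =
      B.restrictPt (AbelianSchemeOver.specTwist σ.toRingEquiv ≫ s) (φ.σ i))
    (heΘ : haveI := AbelianVariety.isDominant_toSchemeHom_iso_hom e.symm
      B.IsLambdaOfAt (AbelianSchemeOver.specTwist σ.toRingEquiv ≫ s) D lam (Θ₂.pullback (AbelianVariety.Hom.toSchemeHom e.symm.hom)))
    (f : ((B.fibre s).toAbelianVariety).conjugate σ.toRingEquiv ⟶ (B'.fibre s').toAbelianVariety)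
    (hk : k ∈ principalLevelSubgroup δ N)
    (hf : ∀ v w : Fin g ⊕ Fin g → ℚ,
      AdelicCongr ((k * a⁻¹ : gspFinAdelic δ) : GL (Fin g ⊕ Fin g) finAdeleQ)
          ((r⁻¹ : gspFinAdelic δ) : GL (Fin g ⊕ Fin g) finAdeleQ) v w →
        AlgPoints.map f.hom.hom.hom ((B.fibre s).toAbelianVariety.conjPoints σ.toRingEquiv (m₁.r v)) = m₂.r w)
    -- the CM hom intertwines a global endomorphism's fibre and an endomorphism of the second fibre ((R-CM-2)'s output)
    (F : B.X ⟶ B.X) [IsMonHom F] (y' : (B'.fibre s').toAbelianVariety ⟶ (B'.fibre s').toAbelianVariety)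
    (hint : AbelianVariety.Hom.conjugate σ.toRingEquiv (fibreHom F s) ≫ f = f ≫ y') :
    y' ≫ e.hom = e.hom ≫ fibreHom F (AbelianSchemeOver.specTwist σ.toRingEquiv ≫ s) := by
  haveI := isIso_of_twisted_reading σ m₁ hZ hδ m₂ f hk hf
  have hfe := comp_iso_hom_eq_conjFibreIso_hom_of_lifts hg hδ hN σ h₁ Λ₁ m₁ hΛ₁ hr hZ m₂ Λ₂ hΛ₂ e he heΘ f hk hf
  -- naturality of the canonical identification
  have hnat := conjugate_fibreHom_comp_conjFibreIso_hom σ.toRingEquiv s F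
  -- `e = f⁻¹ ≫ conjFibreIso`
  have he' : e.hom = inv f ≫ (B.conjFibreIso σ.toRingEquiv s).hom := by rw [← hfe, IsIso.inv_hom_id_assoc]
  calc y' ≫ e.hom = inv f ≫ (f ≫ y') ≫ e.hom := by simp only [Category.assoc, IsIso.inv_hom_id_assoc]
    _ = inv f ≫ (AbelianVariety.Hom.conjugate σ.toRingEquiv (fibreHom F s) ≫ f) ≫ e.hom := by rw [hint]
    _ = inv f ≫ AbelianVariety.Hom.conjugate σ.toRingEquiv (fibreHom F s) ≫ (B.conjFibreIso σ.toRingEquiv s).hom := by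
          simp only [Category.assoc, hfe]
    _ = inv f ≫ (B.conjFibreIso σ.toRingEquiv s).hom ≫ fibreHom F (AbelianSchemeOver.specTwist σ.toRingEquiv ≫ s) := by
          rw [hnat]
    _ = e.hom ≫ fibreHom F (AbelianSchemeOver.specTwist σ.toRingEquiv ≫ s) := by rw [he', Category.assoc]

/-- **The same from READINGS** (★ E6-γ-A₂ `conjugate_comp_eq_comp_of_adelicCongr₂` supplies `hint`): `F_s` reads `ℓ` through `m₁`, `y′` reads `ℓ′` through
`m₂`, for a pair `(ℓ, ℓ′)` preserving the congruence `k a⁻¹ v̂ ≡ r⁻¹ ŵ`; then `y′ ≫ e.hom = e.hom ≫ F_{Spec σ ≫ s}`.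
[cite: Milne2005ShimuraVarieties, §14 Prop. 14.12 p. 125 and §11 Thm. 11.2 p. 108] [cite: Shimura1998, §21.4 p. 192] -/
theorem comp_iso_hom_eq_iso_hom_comp_fibreHom_of_lifts_of_readings (hg : 0 < g) (hδ : IsPolarizationType δ) (hN : 3 ≤ N)
    (σ : ℂ ≃ₐ[ℚ] ℂ)
    {Θ₁ : CartierDivisor (B.fibre s).toAbelianVariety.X.left} (h₁ : B.IsLambdaOfAt s D lam Θ₁)
    (Λ₁ : φ.SymplecticLift s Θ₁ δ) (m₁ : SiegelAdelicMarking J a (B.fibre s).toAbelianVariety)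
    (hΛ₁ : ∀ ⦃M : ℕ⦄, N ∣ M → M ≠ 0 → ∀ (x : Fin g ⊕ Fin g → ZMod M) (v : Fin g ⊕ Fin g → ℚ),
      AdelicCongr ((a⁻¹ : gspFinAdelic δ) : GL (Fin g ⊕ Fin g) finAdeleQ) 1 v (fun i => ((x i).val : ℚ) / M) →
        ((Λ₁.lift M (Multiplicative.ofAdd x)) : (B.fibre s).toAbelianVariety.Points ℂ) = m₁.r v)
    (hr : r ∈ principalLevelSubgroup δ 1) (hZ : Z ∈ siegelUpperHalfSpace g)
    (m₂ : SiegelAdelicMarking ⟨jOfSiegel δ Z, SiegelComplexRecordSystem.jOfSiegel_mem_C0pm hδ.1 hZ⟩ r (B'.fibre s').toAbelianVariety)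
    {Θ₂ : CartierDivisor (B'.fibre s').toAbelianVariety.X.left} (Λ₂ : φ'.SymplecticLift s' Θ₂ δ)
    (hΛ₂ : ∀ ⦃M : ℕ⦄, N ∣ M → M ≠ 0 → ∀ (x : Fin g ⊕ Fin g → ZMod M) (v : Fin g ⊕ Fin g → ℚ),
      AdelicCongr ((r⁻¹ : gspFinAdelic δ) : GL (Fin g ⊕ Fin g) finAdeleQ) 1 v (fun i => ((x i).val : ℚ) / M) →
        ((Λ₂.lift M (Multiplicative.ofAdd x)) : (B'.fibre s').toAbelianVariety.Points ℂ) = m₂.r v)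
    (e : (B'.fibre s').toAbelianVariety ≅ (B.fibre (AbelianSchemeOver.specTwist σ.toRingEquiv ≫ s)).toAbelianVariety)
    (he : ∀ i : Fin g ⊕ Fin g, AlgPoints.map e.hom.hom.hom.hom (B'.restrictPt s' (φ'.σ i)) =
      B.restrictPt (AbelianSchemeOver.specTwist σ.toRingEquiv ≫ s) (φ.σ i))
    (heΘ : haveI := AbelianVariety.isDominant_toSchemeHom_iso_hom e.symm
      B.IsLambdaOfAt (AbelianSchemeOver.specTwist σ.toRingEquiv ≫ s) D lam (Θ₂.pullback (AbelianVariety.Hom.toSchemeHom e.symm.hom)))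
    (f : ((B.fibre s).toAbelianVariety).conjugate σ.toRingEquiv ⟶ (B'.fibre s').toAbelianVariety)
    (hk : k ∈ principalLevelSubgroup δ N)
    (hf : ∀ v w : Fin g ⊕ Fin g → ℚ,
      AdelicCongr ((k * a⁻¹ : gspFinAdelic δ) : GL (Fin g ⊕ Fin g) finAdeleQ)
          ((r⁻¹ : gspFinAdelic δ) : GL (Fin g ⊕ Fin g) finAdeleQ) v w →
        AlgPoints.map f.hom.hom.hom ((B.fibre s).toAbelianVariety.conjPoints σ.toRingEquiv (m₁.r v)) = m₂.r w)
    (ℓ ℓ' : Matrix (Fin g ⊕ Fin g) (Fin g ⊕ Fin g) ℚ)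
    (hℓ : ∀ v w : Fin g ⊕ Fin g → ℚ,
      AdelicCongr ((k * a⁻¹ : gspFinAdelic δ) : GL (Fin g ⊕ Fin g) finAdeleQ)
          ((r⁻¹ : gspFinAdelic δ) : GL (Fin g ⊕ Fin g) finAdeleQ) v w →
        AdelicCongr ((k * a⁻¹ : gspFinAdelic δ) : GL (Fin g ⊕ Fin g) finAdeleQ)
          ((r⁻¹ : gspFinAdelic δ) : GL (Fin g ⊕ Fin g) finAdeleQ) (ℓ *ᵥ v) (ℓ' *ᵥ w))
    (F : B.X ⟶ B.X) [IsMonHom F]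
    (hy : ∀ v : Fin g ⊕ Fin g → ℚ, AlgPoints.map (fibreHom F s).hom.hom.hom (m₁.r v) = m₁.r (ℓ *ᵥ v))
    (y' : (B'.fibre s').toAbelianVariety ⟶ (B'.fibre s').toAbelianVariety)
    (hy' : ∀ w : Fin g ⊕ Fin g → ℚ, AlgPoints.map y'.hom.hom.hom (m₂.r w) = m₂.r (ℓ' *ᵥ w)) :
    y' ≫ e.hom = e.hom ≫ fibreHom F (AbelianSchemeOver.specTwist σ.toRingEquiv ≫ s) :=
  comp_iso_hom_eq_iso_hom_comp_fibreHom_of_lifts hg hδ hN σ h₁ Λ₁ m₁ hΛ₁ hr hZ m₂ Λ₂ hΛ₂ e he heΘ f hk hf F y'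
    (conjugate_comp_eq_comp_of_adelicCongr₂ σ.toRingEquiv m₁ m₂ _ _ f hf ℓ ℓ' hℓ (fibreHom F s) hy y' hy')

end SiegelAdelicMarking

end Literature.AlgebraicGeometry.ModuliOfAbelianVarieties

end
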